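import Summits.QuantumFields.YangMills.Theorems.ColdStartUniversalityLatticeLangevinLiebRobinsonCarreOfLipschitz
import Summits.QuantumFields.YangMills.Theorems.ColdStartUniversalityLatticeLangevinLiebRobinsonWordMixing
import HarnessLib

/-!
# Route `ColdStartUniversality` (fixed-cut-off SZZ dynamics; LIEB–ROBINSON / LOCALITY package, file 10):
# VOLUME-FREE MIXING TIMES of local observables and of fixed Wilson loop words, every start; random starts

Helper file (seat `ym-line-csu-p1`, g30; `--supports stmt-QuantumFields-24809`).  Quotable corollaries of the every-start, volume-free
mixing theorems (`…LiebRobinsonCarreOfLipschitz`, `…LiebRobinsonWordMixing`) at `|β'| < 1/12`, `ρ = 1 − 12|β'|`, `λ = (1300+4√2)|β'|`: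
* §1 elementary: `(1+s)³ ≤ 6eˢ` and the PURE-EXPONENTIAL form of the light-cone polynomial
  `((3at+1)³ + 2)·e^(−ρt) ≤ (6(1+6a/ρ)³ + 2)·e^(−ρt/2)`; `C·e^(−ρt/2) ≤ δ` once `t ≥ (2/ρ)·log(C/δ)`; averaging a pointwise bound over a law.
* §2 ★★★ `wilson_local_mixing_halfRate_of_linkLipschitz` / `wilson_local_mixingTime_of_linkLipschitz`: for a `C⁵` observable with a
  link-Lipschitz profile `ℓ` supported in `Λ`, EVERY start `x`, every volume `L`:
  `|κ_t(f∘coords)(x) − μ_(β')(f∘coords)| ≤ C_f·e^(−ρt/2)`, `C_f = 12π·#Λ·√(Σℓ²)·(6(7+6λ/ρ)³+2)`, hence `≤ δ` for all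
  `t ≥ (2/ρ)·log(C_f/δ)` — a δ-MIXING TIME OF LOCAL OBSERVABLES THAT DOES NOT SEE THE VOLUME (compare the `Θ(log L)` of
  `…MixingTimeExplicit` for general bounded observables).
* §3 ★★★ `wilson_word_mixingTime` / `wilson_solution_word_mixingTime`: a FIXED Wilson loop word `w` (no spatial average) is within `δ` of
  its equilibrium value from every deterministic start (e.g. cold), along every strong solution, for all `t ≥ (2/ρ)·log(12√2π|w|²(6(7+6λ/ρ)³+2)/δ)`.
* §4 ★★ `wilson_local_mixing_initialLaw_of_linkLipschitz`: the same bounds from an arbitrary initial LAW `ν` (average of the every-start bound).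
THEOREMS ONLY, no definition, no sorry; [folklore].  HONEST FRAMING: fixed cut-off and FIXED `|β'| < 1/12`; in the route's scaling
`β'_K = (γε_K)⁻¹/2 → ∞` the window is left, so nothing here is `K`-uniform; `UniformColdStartMixing` (24809) is NOT restated; no crux, rung
or summit statement is proved; the Yang–Mills mass gap is NOT proved.
-/

set_option autoImplicit false

noncomputable section

namespace Summit.QuantumFields.YangMills.Theorems.ColdStartUniversality.LiebRobinson

open MeasureTheory ProbabilityTheory Matrix Complex Finset Filter Set Metric
open scoped ComplexConjugate BigOperators Matrix NNReal ENNReal Topology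
open Literature.Probability.Process Literature.MathematicalPhysics.QuantumFieldTheory
open Literature.MathematicalPhysics.QuantumFieldTheory.Balaban1983to89
open Literature.MathematicalPhysics.QuantumLattice (fundamentalRep fundamentalLatticeRep continuous_fundamentalRep fundamentalRep_apply)

variable {L : ℕ} [NeZero L]

/-! ## §1. Elementary inequalities -/

/-- `(1+s)³ ≤ 6·eˢ` for `s ≥ 0` (`(1+s)³ ≤ 6 + 6s + 3s² + s³ = 6(1 + s + s²/2 + s³/6)`; the cubic Taylor minorant of `exp` is
`Real.sum_le_exp_of_nonneg`, cf. `Literature.NumberTheory.Sieve.JurkatRichert.cubic_le_exp`). [folklore] -/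
theorem one_add_pow_three_le_six_mul_exp {s : ℝ} (hs : 0 ≤ s) : (1 + s) ^ 3 ≤ 6 * Real.exp s := by
  have h : 1 + s + s ^ 2 / 2 + s ^ 3 / 6 ≤ Real.exp s :=
    calc 1 + s + s ^ 2 / 2 + s ^ 3 / 6 = ∑ i ∈ Finset.range 4, s ^ i / (Nat.factorial i : ℝ) := by
          simp only [Finset.sum_range_succ, Finset.range_one, Finset.sum_singleton, pow_zero, Nat.factorial, pow_one, mul_one, Nat.mul_one,
            Nat.cast_succ]
          norm_num
      _ ≤ Real.exp s := Real.sum_le_exp_of_nonneg hs 4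
  nlinarith [h, hs, sq_nonneg s]

/-- **Pure-exponential form of the light-cone polynomial**: for `a ≥ 0`, `ρ > 0`, `t ≥ 0`,
`((3at+1)³ + 2)·e^(−ρt) ≤ (6(1+6a/ρ)³ + 2)·e^(−ρt/2)` (substitute `s = ρt/2`, `1 + (6a/ρ)s ≤ (1+6a/ρ)(1+s)`, `(1+s)³ ≤ 6eˢ`). [folklore] -/
theorem lightCone_poly_mul_exp_le_halfRate {a ρ t : ℝ} (ha : 0 ≤ a) (hρ : 0 < ρ) (ht : 0 ≤ t) :
    ((3 * (a * t) + 1) ^ 3 + 2) * Real.exp (-(ρ * t)) ≤ (6 * (1 + 6 * a / ρ) ^ 3 + 2) * Real.exp (-(ρ / 2 * t)) := by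
  set s : ℝ := ρ / 2 * t with hs
  have hs0 : 0 ≤ s := by positivity
  have hc0 : 0 ≤ 6 * a / ρ := by positivity
  have h1 : 3 * (a * t) + 1 = 1 + 6 * a / ρ * s := by rw [hs]; field_simp; ring
  have h2 : 1 + 6 * a / ρ * s ≤ (1 + 6 * a / ρ) * (1 + s) := by nlinarith [mul_nonneg hc0 hs0, hc0, hs0]
  have h3 : (3 * (a * t) + 1) ^ 3 ≤ (1 + 6 * a / ρ) ^ 3 * (1 + s) ^ 3 := by
    rw [h1, ← mul_pow]
    exact pow_le_pow_left₀ (by positivity) h2 3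
  have h4 : (1 + s) ^ 3 ≤ 6 * Real.exp s := one_add_pow_three_le_six_mul_exp hs0
  have h5 : (1 : ℝ) ≤ Real.exp s := Real.one_le_exp hs0
  have hexp : Real.exp (-(ρ * t)) = Real.exp (-(ρ / 2 * t)) * Real.exp (-s) := by
    rw [← Real.exp_add]; congr 1; rw [hs]; ring
  have hes : Real.exp s * Real.exp (-s) = 1 := by rw [← Real.exp_add, add_neg_cancel, Real.exp_zero]
  have hE0 : 0 ≤ Real.exp (-(ρ / 2 * t)) := (Real.exp_pos _).le
  have hEm : 0 ≤ Real.exp (-s) := (Real.exp_pos _).le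
  have hpoly : (3 * (a * t) + 1) ^ 3 + 2 ≤ (6 * (1 + 6 * a / ρ) ^ 3 + 2) * Real.exp s := by
    have hA : 0 ≤ (1 + 6 * a / ρ) ^ 3 := by positivity
    nlinarith [h3, h4, h5, hA, mul_le_mul_of_nonneg_left h4 hA]
  calc ((3 * (a * t) + 1) ^ 3 + 2) * Real.exp (-(ρ * t))
      = ((3 * (a * t) + 1) ^ 3 + 2) * Real.exp (-s) * Real.exp (-(ρ / 2 * t)) := by rw [hexp]; ring
    _ ≤ ((6 * (1 + 6 * a / ρ) ^ 3 + 2) * Real.exp s) * Real.exp (-s) * Real.exp (-(ρ / 2 * t)) :=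
        mul_le_mul_of_nonneg_right (mul_le_mul_of_nonneg_right hpoly hEm) hE0
    _ = (6 * (1 + 6 * a / ρ) ^ 3 + 2) * Real.exp (-(ρ / 2 * t)) := by
        rw [mul_assoc (6 * (1 + 6 * a / ρ) ^ 3 + 2), hes, mul_one]

/-- `C·e^(−ρt/2) ≤ δ` as soon as `t ≥ (2/ρ)·log(C/δ)` (`C ≥ 0`, `δ > 0`, `ρ > 0`). [folklore] -/
theorem const_mul_exp_halfRate_le_of_log_le {C δ ρ t : ℝ} (hC : 0 ≤ C) (hδ : 0 < δ) (hρ : 0 < ρ)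
    (ht : 2 / ρ * Real.log (C / δ) ≤ t) : C * Real.exp (-(ρ / 2 * t)) ≤ δ := by
  rcases eq_or_lt_of_le hC with hC0 | hCpos
  · rw [← hC0, zero_mul]; exact hδ.le
  have h1 : Real.log (C / δ) ≤ ρ / 2 * t := by
    have h := mul_le_mul_of_nonneg_left ht (le_of_lt (half_pos hρ))
    have h' : ρ / 2 * (2 / ρ * Real.log (C / δ)) = Real.log (C / δ) := by field_simp
    linarith [h, h']
  have h2 : C / δ ≤ Real.exp (ρ / 2 * t) := by
    have := Real.exp_le_exp.2 h1
    rwa [Real.exp_log (div_pos hCpos hδ)] at this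
  have hE : 0 < Real.exp (ρ / 2 * t) := Real.exp_pos _
  rw [div_le_iff₀ hδ] at h2
  rw [Real.exp_neg, ← div_eq_mul_inv, div_le_iff₀ hE]
  linarith [h2]

/-- **Averaging a pointwise bound over a law**: if `|g(x) − c| ≤ B` for every `x` and `g` is strongly measurable, then
`|∫ g dν − c| ≤ B` for every probability measure `ν`. [folklore] -/
theorem abs_integral_sub_le_of_forall {α : Type*} [MeasurableSpace α] (ν : Measure α) [IsProbabilityMeasure ν] {g : α → ℝ}
    (hg : StronglyMeasurable g) {c B : ℝ} (h : ∀ x, |g x - c| ≤ B) : |∫ x, g x ∂ν - c| ≤ B := by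
  have hgi : Integrable g ν := by
    refine (integrable_const (|c| + B)).mono' hg.aestronglyMeasurable (ae_of_all _ fun x => ?_)
    rw [Real.norm_eq_abs]
    have := h x
    have h2 : |g x| ≤ |g x - c| + |c| := by
      calc |g x| = |(g x - c) + c| := by ring_nf
        _ ≤ |g x - c| + |c| := abs_add_le _ _
    linarith
  have hsub : ∫ x, g x ∂ν - c = ∫ x, (g x - c) ∂ν := by
    rw [integral_sub hgi (integrable_const c), integral_const, smul_eq_mul, probReal_univ, one_mul]
  rw [hsub]
  calc |∫ x, (g x - c) ∂ν| ≤ ∫ x, |g x - c| ∂ν := abs_integral_le_integral_abs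
    _ ≤ ∫ _x, B ∂ν := integral_mono (hgi.sub (integrable_const c)).abs (integrable_const B) fun x => h x
    _ = B := by rw [integral_const, smul_eq_mul, probReal_univ, one_mul]

/-! ## §2. Volume-free mixing times of local observables, every start -/

/-- `0 ≤ λ + ρ`, `0 < ρ` bookkeeping: the pure-exponential form of the every-start local mixing bound.  ★★★ For a `C⁵` observable `f`
with a link-Lipschitz profile `ℓ ≥ 0` supported in `Λ`, at `|β'| < 1/12`, every volume, every realising kernel family, every `t`, EVERY start:
`|κ_t(f∘coords)(x) − μ_(β')(f∘coords)| ≤ 12π·#Λ·√(Σℓ²)·(6(7+6λ/ρ)³+2)·e^(−ρt/2)`. [folklore] -/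
theorem wilson_local_mixing_halfRate_of_linkLipschitz (L : ℕ) [NeZero L] (β' : ℝ) (hβ : |β'| < 1 / 12)
    (κ : ℝ≥0 → Kernel (GaugeConfig 3 L (Matrix.specialUnitaryGroup (Fin 2) ℂ))
      (GaugeConfig 3 L (Matrix.specialUnitaryGroup (Fin 2) ℂ))) [∀ t, IsMarkovKernel (κ t)]
    (hreal : ∀ (t : ℝ≥0) (x : GaugeConfig 3 L (Matrix.specialUnitaryGroup (Fin 2) ℂ))
        (Ω : Type) [MeasurableSpace Ω] (P : Measure Ω) [IsProbabilityMeasure P]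
        (W : ℝ≥0 → Ω → (Edge 3 L × NoiseIdx 2 → ℝ)) (hW : IsFlatBrownian W P)
        (U : ℝ≥0 → Ω → GaugeConfig 3 L (Matrix.specialUnitaryGroup (Fin 2) ℂ)),
        (∀ ω, U 0 ω = x) →
        (latticeLangevinDynamics (fundamentalLatticeRep 2) β').IsSolution (fundamentalRep (Fin 2))
          hW.natFiltration P W U →
        κ t x = P.map (U t))
    {f : (Edge 3 L × Fin 2 × Fin 2 × Bool → ℝ) → ℝ} (hf : ContDiff ℝ 5 f) (Λ : Finset (Edge 3 L)) {ℓ : Edge 3 L → ℝ} (hℓ : ∀ e, 0 ≤ ℓ e)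
    (hℓΛ : ∀ e, e ∉ Λ → ℓ e = 0) (t : ℝ≥0) :
    let coords : GaugeConfig 3 L (Matrix.specialUnitaryGroup (Fin 2) ℂ) → (Edge 3 L × Fin 2 × Fin 2 × Bool → ℝ) :=
      fun V q => (fun z : ℂ => if q.2.2.2 then z.im else z.re)
        ((fundamentalRep (Fin 2) (V q.1) : Matrix (Fin 2) (Fin 2) ℂ) q.2.1 q.2.2.1)
    (∀ (e : Edge 3 L) (y y' : (GaugeConfig 3 L (Matrix.specialUnitaryGroup (Fin 2) ℂ))), (∀ g, g ≠ e → y g = y' g) →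
      |f (coords y) - f (coords y')| ≤ ℓ e * frobNorm ((y e : Matrix (Fin 2) (Fin 2) ℂ) - (y' e : Matrix (Fin 2) (Fin 2) ℂ))) →
    ∀ x, |∫ y, f (coords y) ∂(κ t x) - ∫ y, f (coords y) ∂(wilsonMeasure (d := 3) (L := L) (fundamentalRep (Fin 2)) β')| ≤
      12 * Real.pi * Λ.card * Real.sqrt (∑ e : Edge 3 L, ℓ e ^ 2) * (6 * (7 + 6 * ((1300 + 4 * Real.sqrt 2) * |β'|) / (1 - 12 * |β'|)) ^ 3 + 2) * Real.exp (-((1 - 12 * |β'|) / 2 * (t : ℝ))) := by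
  intro coords hLip x
  have h := wilson_local_pointwise_mixing_of_linkLipschitz L β' hβ κ hreal hf Λ hℓ hℓΛ t hLip x
  have hρ : 0 < (1 - 12 * |β'|) := by linarith
  have ha : 0 ≤ ((1300 + 4 * Real.sqrt 2) * |β'|) + (1 - 12 * |β'|) := by positivity
  have hpoly := lightCone_poly_mul_exp_le_halfRate ha hρ (NNReal.coe_nonneg t)
  have hK : 0 ≤ 12 * Real.pi * Λ.card * Real.sqrt (∑ e : Edge 3 L, ℓ e ^ 2) := by positivity
  have h7 : 1 + 6 * (((1300 + 4 * Real.sqrt 2) * |β'|) + (1 - 12 * |β'|)) / (1 - 12 * |β'|) = 7 + 6 * ((1300 + 4 * Real.sqrt 2) * |β'|) / (1 - 12 * |β'|) := by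
    have h6 : (6 : ℝ) * (1 - 12 * |β'|) / (1 - 12 * |β'|) = 6 := mul_div_cancel_right₀ 6 hρ.ne'
    calc 1 + 6 * (((1300 + 4 * Real.sqrt 2) * |β'|) + (1 - 12 * |β'|)) / (1 - 12 * |β'|) = 1 + (6 * ((1300 + 4 * Real.sqrt 2) * |β'|) / (1 - 12 * |β'|) + 6 * (1 - 12 * |β'|) / (1 - 12 * |β'|)) := by
          rw [mul_add, add_div]
      _ = 7 + 6 * ((1300 + 4 * Real.sqrt 2) * |β'|) / (1 - 12 * |β'|) := by rw [h6]; ring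
  rw [h7] at hpoly
  calc |∫ y, f (coords y) ∂(κ t x) - ∫ y, f (coords y) ∂(wilsonMeasure (d := 3) (L := L) (fundamentalRep (Fin 2)) β')|
      ≤ 12 * Real.pi * Λ.card * Real.sqrt (∑ e : Edge 3 L, ℓ e ^ 2) * ((3 * (((1300 + 4 * Real.sqrt 2) * |β'| + (1 - 12 * |β'|)) * (t : ℝ)) + 1) ^ 3 + 2) * Real.exp (-((1 - 12 * |β'|) * (t : ℝ))) := h
    _ = 12 * Real.pi * Λ.card * Real.sqrt (∑ e : Edge 3 L, ℓ e ^ 2) * (((3 * (((1300 + 4 * Real.sqrt 2) * |β'| + (1 - 12 * |β'|)) * (t : ℝ)) + 1) ^ 3 + 2) * Real.exp (-((1 - 12 * |β'|) * (t : ℝ)))) := by ring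
    _ ≤ 12 * Real.pi * Λ.card * Real.sqrt (∑ e : Edge 3 L, ℓ e ^ 2) * ((6 * (7 + 6 * ((1300 + 4 * Real.sqrt 2) * |β'|) / (1 - 12 * |β'|)) ^ 3 + 2) * Real.exp (-((1 - 12 * |β'|) / 2 * (t : ℝ)))) := mul_le_mul_of_nonneg_left hpoly hK
    _ = 12 * Real.pi * Λ.card * Real.sqrt (∑ e : Edge 3 L, ℓ e ^ 2) * (6 * (7 + 6 * ((1300 + 4 * Real.sqrt 2) * |β'|) / (1 - 12 * |β'|)) ^ 3 + 2) * Real.exp (-((1 - 12 * |β'|) / 2 * (t : ℝ))) := by ring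

/-- ★★★ **A δ-mixing time of local observables that does not see the volume.**  At `|β'| < 1/12`, for every torus size `L`, every
realising kernel family, every `C⁵` observable `f` with a link-Lipschitz profile `ℓ ≥ 0` supported in `Λ`, every `δ > 0`, EVERY start `x`
and every `t ≥ (2/ρ)·log(C_f/δ)`, `C_f = 12π·#Λ·√(Σℓ²)·(6(7+6λ/ρ)³+2)`: `|κ_t(f∘coords)(x) − μ_(β')(f∘coords)| ≤ δ`.  The threshold depends on
`f` only through `#Λ` and `Σℓ²` — NOT on `L` (contrast: `Θ(log L)` for general bounded observables, `…MixingTimeExplicit`).  Fixed cut-off,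
fixed `|β'| < 1/12`; 24809 NOT restated. [folklore] -/
theorem wilson_local_mixingTime_of_linkLipschitz (L : ℕ) [NeZero L] (β' : ℝ) (hβ : |β'| < 1 / 12)
    (κ : ℝ≥0 → Kernel (GaugeConfig 3 L (Matrix.specialUnitaryGroup (Fin 2) ℂ))
      (GaugeConfig 3 L (Matrix.specialUnitaryGroup (Fin 2) ℂ))) [∀ t, IsMarkovKernel (κ t)]
    (hreal : ∀ (t : ℝ≥0) (x : GaugeConfig 3 L (Matrix.specialUnitaryGroup (Fin 2) ℂ))
        (Ω : Type) [MeasurableSpace Ω] (P : Measure Ω) [IsProbabilityMeasure P]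
        (W : ℝ≥0 → Ω → (Edge 3 L × NoiseIdx 2 → ℝ)) (hW : IsFlatBrownian W P)
        (U : ℝ≥0 → Ω → GaugeConfig 3 L (Matrix.specialUnitaryGroup (Fin 2) ℂ)),
        (∀ ω, U 0 ω = x) →
        (latticeLangevinDynamics (fundamentalLatticeRep 2) β').IsSolution (fundamentalRep (Fin 2))
          hW.natFiltration P W U →
        κ t x = P.map (U t))
    {f : (Edge 3 L × Fin 2 × Fin 2 × Bool → ℝ) → ℝ} (hf : ContDiff ℝ 5 f) (Λ : Finset (Edge 3 L)) {ℓ : Edge 3 L → ℝ} (hℓ : ∀ e, 0 ≤ ℓ e)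
    (hℓΛ : ∀ e, e ∉ Λ → ℓ e = 0) {δ : ℝ} (hδ : 0 < δ) (t : ℝ≥0)
    (ht : 2 / (1 - 12 * |β'|) * Real.log (12 * Real.pi * Λ.card * Real.sqrt (∑ e : Edge 3 L, ℓ e ^ 2) * (6 * (7 + 6 * ((1300 + 4 * Real.sqrt 2) * |β'|) / (1 - 12 * |β'|)) ^ 3 + 2) / δ) ≤ (t : ℝ)) :
    let coords : GaugeConfig 3 L (Matrix.specialUnitaryGroup (Fin 2) ℂ) → (Edge 3 L × Fin 2 × Fin 2 × Bool → ℝ) :=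
      fun V q => (fun z : ℂ => if q.2.2.2 then z.im else z.re)
        ((fundamentalRep (Fin 2) (V q.1) : Matrix (Fin 2) (Fin 2) ℂ) q.2.1 q.2.2.1)
    (∀ (e : Edge 3 L) (y y' : (GaugeConfig 3 L (Matrix.specialUnitaryGroup (Fin 2) ℂ))), (∀ g, g ≠ e → y g = y' g) →
      |f (coords y) - f (coords y')| ≤ ℓ e * frobNorm ((y e : Matrix (Fin 2) (Fin 2) ℂ) - (y' e : Matrix (Fin 2) (Fin 2) ℂ))) →
    ∀ x, |∫ y, f (coords y) ∂(κ t x) - ∫ y, f (coords y) ∂(wilsonMeasure (d := 3) (L := L) (fundamentalRep (Fin 2)) β')| ≤ δ := by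
  intro coords hLip x
  have h := wilson_local_mixing_halfRate_of_linkLipschitz L β' hβ κ hreal hf Λ hℓ hℓΛ t hLip x
  have hρ : 0 < (1 - 12 * |β'|) := by linarith
  have hC : 0 ≤ 12 * Real.pi * Λ.card * Real.sqrt (∑ e : Edge 3 L, ℓ e ^ 2) * (6 * (7 + 6 * ((1300 + 4 * Real.sqrt 2) * |β'|) / (1 - 12 * |β'|)) ^ 3 + 2) := by positivity
  exact h.trans (const_mul_exp_halfRate_le_of_log_le hC hδ hρ ht)

/-- ★★★ **Along every SZZ solution from a deterministic start** (e.g. the COLD start): for every `C⁵` `f` with a link-Lipschitz profile `ℓ`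
supported in `Λ`, every `δ > 0` and every `t ≥ (2/ρ)·log(C_f/δ)`: `|E[f(coords U_t)] − μ_(β')(f∘coords)| ≤ δ`, every volume. [folklore] -/
theorem wilson_solution_local_mixingTime_of_linkLipschitz (L : ℕ) [NeZero L] (β' : ℝ) (hβ : |β'| < 1 / 12) (t : ℝ≥0)
    (x₀ : (GaugeConfig 3 L (Matrix.specialUnitaryGroup (Fin 2) ℂ)))
    (Ω : Type) [MeasurableSpace Ω] (P : Measure Ω) [IsProbabilityMeasure P]
    (W : ℝ≥0 → Ω → (Edge 3 L × NoiseIdx 2 → ℝ)) (hW : IsFlatBrownian W P)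
    (U : ℝ≥0 → Ω → (GaugeConfig 3 L (Matrix.specialUnitaryGroup (Fin 2) ℂ))) (hU0 : ∀ ω, U 0 ω = x₀)
    (hU : (latticeLangevinDynamics (fundamentalLatticeRep 2) β').IsSolution (fundamentalRep (Fin 2)) hW.natFiltration P W U)
    {f : (Edge 3 L × Fin 2 × Fin 2 × Bool → ℝ) → ℝ} (hf : ContDiff ℝ 5 f) (Λ : Finset (Edge 3 L)) {ℓ : Edge 3 L → ℝ} (hℓ : ∀ e, 0 ≤ ℓ e)
    (hℓΛ : ∀ e, e ∉ Λ → ℓ e = 0) {δ : ℝ} (hδ : 0 < δ)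
    (ht : 2 / (1 - 12 * |β'|) * Real.log (12 * Real.pi * Λ.card * Real.sqrt (∑ e : Edge 3 L, ℓ e ^ 2) * (6 * (7 + 6 * ((1300 + 4 * Real.sqrt 2) * |β'|) / (1 - 12 * |β'|)) ^ 3 + 2) / δ) ≤ (t : ℝ)) :
    let coords : GaugeConfig 3 L (Matrix.specialUnitaryGroup (Fin 2) ℂ) → (Edge 3 L × Fin 2 × Fin 2 × Bool → ℝ) :=
      fun V q => (fun z : ℂ => if q.2.2.2 then z.im else z.re)
        ((fundamentalRep (Fin 2) (V q.1) : Matrix (Fin 2) (Fin 2) ℂ) q.2.1 q.2.2.1)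
    (∀ (e : Edge 3 L) (y y' : (GaugeConfig 3 L (Matrix.specialUnitaryGroup (Fin 2) ℂ))), (∀ g, g ≠ e → y g = y' g) →
      |f (coords y) - f (coords y')| ≤ ℓ e * frobNorm ((y e : Matrix (Fin 2) (Fin 2) ℂ) - (y' e : Matrix (Fin 2) (Fin 2) ℂ))) →
    |∫ ω, f (coords (U t ω)) ∂P - ∫ y, f (coords y) ∂(wilsonMeasure (d := 3) (L := L) (fundamentalRep (Fin 2)) β')| ≤ δ := by
  intro coords hLip
  classical
  haveI := secondCountableTopology_su2
  haveI := borelSpace_config L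
  obtain ⟨κ, hκ, -, hreal⟩ := exists_transitionKernel L β'
  haveI := hκ
  have h := wilson_local_mixingTime_of_linkLipschitz L β' hβ κ hreal hf Λ hℓ hℓΛ hδ t ht hLip x₀
  have hlaw : κ t x₀ = P.map (U t) := hreal t x₀ Ω P W hW U hU0 hU
  have hmU : Measurable (U t) := (hU.adapted t).mono (hW.natFiltration.le t) le_rfl
  have hFm : Measurable fun y : (GaugeConfig 3 L (Matrix.specialUnitaryGroup (Fin 2) ℂ)) => f (coords y) :=
    (hf.continuous.comp (continuous_coords (L := L))).measurable
  have e1 : ∫ y, f (coords y) ∂(κ t x₀) = ∫ ω, f (coords (U t ω)) ∂P := by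
    rw [hlaw, integral_map hmU.aemeasurable hFm.aestronglyMeasurable]
  rw [← e1]
  exact h

/-! ## §3. Volume-free mixing times of fixed Wilson loop words -/

/-- ★★★ **Mixing time of a FIXED Wilson loop word, every start, every volume.**  At `|β'| < 1/12`, for every word `w` of link matrices /
adjoints (a plaquette, an `R × T` loop at a fixed position — no spatial average), every realising kernel family, every `δ > 0`, EVERY start
`x` and every `t ≥ (2/ρ)·log(12√2π|w|²(6(7+6λ/ρ)³+2)/δ)`: `|κ_t(Re tr w)(x) − ∫ Re tr w dμ_(β')| ≤ δ`. [folklore] -/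
theorem wilson_word_mixingTime (L : ℕ) [NeZero L] (β' : ℝ) (hβ : |β'| < 1 / 12)
    (κ : ℝ≥0 → Kernel (GaugeConfig 3 L (Matrix.specialUnitaryGroup (Fin 2) ℂ))
      (GaugeConfig 3 L (Matrix.specialUnitaryGroup (Fin 2) ℂ))) [∀ t, IsMarkovKernel (κ t)]
    (hreal : ∀ (t : ℝ≥0) (x : GaugeConfig 3 L (Matrix.specialUnitaryGroup (Fin 2) ℂ))
        (Ω : Type) [MeasurableSpace Ω] (P : Measure Ω) [IsProbabilityMeasure P]
        (W : ℝ≥0 → Ω → (Edge 3 L × NoiseIdx 2 → ℝ)) (hW : IsFlatBrownian W P)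
        (U : ℝ≥0 → Ω → GaugeConfig 3 L (Matrix.specialUnitaryGroup (Fin 2) ℂ)),
        (∀ ω, U 0 ω = x) →
        (latticeLangevinDynamics (fundamentalLatticeRep 2) β').IsSolution (fundamentalRep (Fin 2))
          hW.natFiltration P W U →
        κ t x = P.map (U t))
    (l : List (Edge 3 L × Bool)) {δ : ℝ} (hδ : 0 < δ) (t : ℝ≥0)
    (ht : 2 / (1 - 12 * |β'|) * Real.log (12 * Real.sqrt 2 * Real.pi * (l.length : ℝ) ^ 2 * (6 * (7 + 6 * ((1300 + 4 * Real.sqrt 2) * |β'|) / (1 - 12 * |β'|)) ^ 3 + 2) / δ) ≤ (t : ℝ))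
    (x : (GaugeConfig 3 L (Matrix.specialUnitaryGroup (Fin 2) ℂ))) :
    let coords : GaugeConfig 3 L (Matrix.specialUnitaryGroup (Fin 2) ℂ) → (Edge 3 L × Fin 2 × Fin 2 × Bool → ℝ) :=
      fun V q => (fun z : ℂ => if q.2.2.2 then z.im else z.re)
        ((fundamentalRep (Fin 2) (V q.1) : Matrix (Fin 2) (Fin 2) ℂ) q.2.1 q.2.2.1)
    |∫ y, (fun y : (Edge 3 L × Fin 2 × Fin 2 × Bool → ℝ) => ((l.map (fun a : Edge 3 L × Bool => if a.2 then ((fun (ee : Edge 3 L) => Matrix.of fun (i j : Fin 2) => ((y (ee, i, j, false) : ℝ) : ℂ) + ((y (ee, i, j, true) : ℝ) : ℂ) * Complex.I) a.1)ᴴ else (fun (ee : Edge 3 L) => Matrix.of fun (i j : Fin 2) => ((y (ee, i, j, false) : ℝ) : ℂ) + ((y (ee, i, j, true) : ℝ) : ℂ) * Complex.I) a.1)).prod).trace.re) (coords y) ∂(κ t x) - ∫ y, (fun y : (Edge 3 L × Fin 2 × Fin 2 × Bool → ℝ) => ((l.map (fun a : Edge 3 L × Bool => if a.2 then ((fun (ee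 : Edge 3 L) => Matrix.of fun (i j : Fin 2) => ((y (ee, i, j, false) : ℝ) : ℂ) + ((y (ee, i, j, true) : ℝ) : ℂ) * Complex.I) a.1)ᴴ else (fun (ee : Edge 3 L) => Matrix.of fun (i j : Fin 2) => ((y (ee, i, j, false) : ℝ) : ℂ) + ((y (ee, i, j, true) : ℝ) : ℂ) * Complex.I) a.1)).prod).trace.re) (coords y) ∂(wilsonMeasure (d := 3) (L := L) (fundamentalRep (Fin 2)) β')| ≤ δ := by
  intro coords
  have h := wilson_word_pointwise_mixing_uniform L β' hβ κ hreal l t x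
  have hρ : 0 < (1 - 12 * |β'|) := by linarith
  have ha : 0 ≤ ((1300 + 4 * Real.sqrt 2) * |β'|) + (1 - 12 * |β'|) := by positivity
  have hpoly := lightCone_poly_mul_exp_le_halfRate ha hρ (NNReal.coe_nonneg t)
  have h7 : 1 + 6 * (((1300 + 4 * Real.sqrt 2) * |β'|) + (1 - 12 * |β'|)) / (1 - 12 * |β'|) = 7 + 6 * ((1300 + 4 * Real.sqrt 2) * |β'|) / (1 - 12 * |β'|) := by
    have h6 : (6 : ℝ) * (1 - 12 * |β'|) / (1 - 12 * |β'|) = 6 := mul_div_cancel_right₀ 6 hρ.ne'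
    calc 1 + 6 * (((1300 + 4 * Real.sqrt 2) * |β'|) + (1 - 12 * |β'|)) / (1 - 12 * |β'|) = 1 + (6 * ((1300 + 4 * Real.sqrt 2) * |β'|) / (1 - 12 * |β'|) + 6 * (1 - 12 * |β'|) / (1 - 12 * |β'|)) := by
          rw [mul_add, add_div]
      _ = 7 + 6 * ((1300 + 4 * Real.sqrt 2) * |β'|) / (1 - 12 * |β'|) := by rw [h6]; ring
  rw [h7] at hpoly
  have hK : 0 ≤ 12 * Real.sqrt 2 * Real.pi * (l.length : ℝ) ^ 2 := by positivity
  have hC : 0 ≤ 12 * Real.sqrt 2 * Real.pi * (l.length : ℝ) ^ 2 * (6 * (7 + 6 * ((1300 + 4 * Real.sqrt 2) * |β'|) / (1 - 12 * |β'|)) ^ 3 + 2) := by positivity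
  have h2 : |∫ y, (fun y : (Edge 3 L × Fin 2 × Fin 2 × Bool → ℝ) => ((l.map (fun a : Edge 3 L × Bool => if a.2 then ((fun (ee : Edge 3 L) => Matrix.of fun (i j : Fin 2) => ((y (ee, i, j, false) : ℝ) : ℂ) + ((y (ee, i, j, true) : ℝ) : ℂ) * Complex.I) a.1)ᴴ else (fun (ee : Edge 3 L) => Matrix.of fun (i j : Fin 2) => ((y (ee, i, j, false) : ℝ) : ℂ) + ((y (ee, i, j, true) : ℝ) : ℂ) * Complex.I) a.1)).prod).trace.re) (coords y) ∂(κ t x) - ∫ y, (fun y : (Edge 3 L × Fin 2 × Fin 2 × Bool → ℝ) => ((l.map (fun a : Edge 3 L × Bool => if a.2 then ((fun (ee : Edge 3 L) => Matrix.of fun (i j : Fin 2) => ((y (ee, i, j, false) : ℝ) : ℂ) + ((y (ee, i, j, true) : ℝ) : ℂ) * Complex.I) a.1)ᴴ else (fun (ee : Edge 3 L) => Matrix.of fun (i j : Fin 2) => ((y (ee, i, j, false) : ℝ) : ℂ) + ((y (ee, i, j, true) : ℝ) : ℂ) * Complex.I) a.1)).prod).trace.re) (coords y) ∂(wilsonMeasure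 (d := 3) (L := L) (fundamentalRep (Fin 2)) β')| ≤
      12 * Real.sqrt 2 * Real.pi * (l.length : ℝ) ^ 2 * (6 * (7 + 6 * ((1300 + 4 * Real.sqrt 2) * |β'|) / (1 - 12 * |β'|)) ^ 3 + 2) * Real.exp (-((1 - 12 * |β'|) / 2 * (t : ℝ))) :=
    calc |∫ y, (fun y : (Edge 3 L × Fin 2 × Fin 2 × Bool → ℝ) => ((l.map (fun a : Edge 3 L × Bool => if a.2 then ((fun (ee : Edge 3 L) => Matrix.of fun (i j : Fin 2) => ((y (ee, i, j, false) : ℝ) : ℂ) + ((y (ee, i, j, true) : ℝ) : ℂ) * Complex.I) a.1)ᴴ else (fun (ee : Edge 3 L) => Matrix.of fun (i j : Fin 2) => ((y (ee, i, j, false) : ℝ) : ℂ) + ((y (ee, i, j, true) : ℝ) : ℂ) * Complex.I) a.1)).prod).trace.re) (coords y) ∂(κ t x) - ∫ y, (fun y : (Edge 3 L × Fin 2 × Fin 2 × Bool → ℝ) => ((l.map (fun a : Edge 3 L × Bool => if a.2 then ((fun (ee : Edge 3 L) => Matrix.of fun (i j : Fin 2) => ((y (ee, i, j, false) : ℝ)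 : ℂ) + ((y (ee, i, j, true) : ℝ) : ℂ) * Complex.I) a.1)ᴴ else (fun (ee : Edge 3 L) => Matrix.of fun (i j : Fin 2) => ((y (ee, i, j, false) : ℝ) : ℂ) + ((y (ee, i, j, true) : ℝ) : ℂ) * Complex.I) a.1)).prod).trace.re) (coords y) ∂(wilsonMeasure (d := 3) (L := L) (fundamentalRep (Fin 2)) β')|
        ≤ 12 * Real.sqrt 2 * Real.pi * (l.length : ℝ) ^ 2 * ((3 * (((1300 + 4 * Real.sqrt 2) * |β'| + (1 - 12 * |β'|)) * (t : ℝ)) + 1) ^ 3 + 2) * Real.exp (-((1 - 12 * |β'|) * (t : ℝ))) := h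
      _ = 12 * Real.sqrt 2 * Real.pi * (l.length : ℝ) ^ 2 * (((3 * (((1300 + 4 * Real.sqrt 2) * |β'| + (1 - 12 * |β'|)) * (t : ℝ)) + 1) ^ 3 + 2) * Real.exp (-((1 - 12 * |β'|) * (t : ℝ)))) := by ring
      _ ≤ 12 * Real.sqrt 2 * Real.pi * (l.length : ℝ) ^ 2 * ((6 * (7 + 6 * ((1300 + 4 * Real.sqrt 2) * |β'|) / (1 - 12 * |β'|)) ^ 3 + 2) * Real.exp (-((1 - 12 * |β'|) / 2 * (t : ℝ)))) := mul_le_mul_of_nonneg_left hpoly hK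
      _ = 12 * Real.sqrt 2 * Real.pi * (l.length : ℝ) ^ 2 * (6 * (7 + 6 * ((1300 + 4 * Real.sqrt 2) * |β'|) / (1 - 12 * |β'|)) ^ 3 + 2) * Real.exp (-((1 - 12 * |β'|) / 2 * (t : ℝ))) := by ring
  exact h2.trans (const_mul_exp_halfRate_le_of_log_le hC hδ hρ ht)

/-- ★★★ **Along every SZZ solution from a deterministic start** (e.g. COLD): a fixed Wilson loop word `w` satisfies
`|E[Re tr w(U_t)] − ∫ Re tr w dμ_(β')| ≤ δ` for all `t ≥ (2/ρ)·log(12√2π|w|²(6(7+6λ/ρ)³+2)/δ)`, in every volume `L` — for a plaquette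
`|w|² = 16`.  Fixed cut-off, fixed `|β'| < 1/12`; nothing `K`-uniform; 24809 NOT restated. [folklore] -/
theorem wilson_solution_word_mixingTime (L : ℕ) [NeZero L] (β' : ℝ) (hβ : |β'| < 1 / 12) (t : ℝ≥0)
    (x₀ : (GaugeConfig 3 L (Matrix.specialUnitaryGroup (Fin 2) ℂ))) (Ω : Type) [MeasurableSpace Ω] (P : Measure Ω) [IsProbabilityMeasure P]
    (W : ℝ≥0 → Ω → (Edge 3 L × NoiseIdx 2 → ℝ)) (hW : IsFlatBrownian W P)
    (U : ℝ≥0 → Ω → (GaugeConfig 3 L (Matrix.specialUnitaryGroup (Fin 2) ℂ))) (hU0 : ∀ ω, U 0 ω = x₀)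
    (hU : (latticeLangevinDynamics (fundamentalLatticeRep 2) β').IsSolution (fundamentalRep (Fin 2)) hW.natFiltration P W U)
    (l : List (Edge 3 L × Bool)) {δ : ℝ} (hδ : 0 < δ)
    (ht : 2 / (1 - 12 * |β'|) * Real.log (12 * Real.sqrt 2 * Real.pi * (l.length : ℝ) ^ 2 * (6 * (7 + 6 * ((1300 + 4 * Real.sqrt 2) * |β'|) / (1 - 12 * |β'|)) ^ 3 + 2) / δ) ≤ (t : ℝ)) :
    let coords : GaugeConfig 3 L (Matrix.specialUnitaryGroup (Fin 2) ℂ) → (Edge 3 L × Fin 2 × Fin 2 × Bool → ℝ) :=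
      fun V q => (fun z : ℂ => if q.2.2.2 then z.im else z.re)
        ((fundamentalRep (Fin 2) (V q.1) : Matrix (Fin 2) (Fin 2) ℂ) q.2.1 q.2.2.1)
    |∫ ω, (fun y : (Edge 3 L × Fin 2 × Fin 2 × Bool → ℝ) => ((l.map (fun a : Edge 3 L × Bool => if a.2 then ((fun (ee : Edge 3 L) => Matrix.of fun (i j : Fin 2) => ((y (ee, i, j, false) : ℝ) : ℂ) + ((y (ee, i, j, true) : ℝ) : ℂ) * Complex.I) a.1)ᴴ else (fun (ee : Edge 3 L) => Matrix.of fun (i j : Fin 2) => ((y (ee, i, j, false) : ℝ) : ℂ) + ((y (ee, i, j, true) : ℝ) : ℂ) * Complex.I) a.1)).prod).trace.re) (coords (U t ω)) ∂P - ∫ y, (fun y : (Edge 3 L × Fin 2 × Fin 2 × Bool → ℝ) => ((l.map (fun a : Edge 3 L × Bool => if a.2 then ((fun (ee : Edge 3 L) => Matrix.of fun (i j : Fin 2) => ((y (ee, i, j, false) : ℝ) : ℂ) + ((y (ee, i, j, true) : ℝ) : ℂ) * Complex.I) a.1)ᴴ else (fun (ee : Edge 3 L) => Matrix.of fun (i j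 : Fin 2) => ((y (ee, i, j, false) : ℝ) : ℂ) + ((y (ee, i, j, true) : ℝ) : ℂ) * Complex.I) a.1)).prod).trace.re) (coords y) ∂(wilsonMeasure (d := 3) (L := L) (fundamentalRep (Fin 2)) β')| ≤ δ := by
  intro coords
  classical
  haveI := secondCountableTopology_su2
  haveI := borelSpace_config L
  obtain ⟨κ, hκ, -, hreal⟩ := exists_transitionKernel L β'
  haveI := hκ
  have h := wilson_word_mixingTime L β' hβ κ hreal l hδ t ht x₀
  have hlaw : κ t x₀ = P.map (U t) := hreal t x₀ Ω P W hW U hU0 hU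
  have hmU : Measurable (U t) := (hU.adapted t).mono (hW.natFiltration.le t) le_rfl
  have hFm : Measurable fun y : (GaugeConfig 3 L (Matrix.specialUnitaryGroup (Fin 2) ℂ)) => (fun y : (Edge 3 L × Fin 2 × Fin 2 × Bool → ℝ) => ((l.map (fun a : Edge 3 L × Bool => if a.2 then ((fun (ee : Edge 3 L) => Matrix.of fun (i j : Fin 2) => ((y (ee, i, j, false) : ℝ) : ℂ) + ((y (ee, i, j, true) : ℝ) : ℂ) * Complex.I) a.1)ᴴ else (fun (ee : Edge 3 L) => Matrix.of fun (i j : Fin 2) => ((y (ee, i, j, false) : ℝ) : ℂ) + ((y (ee, i, j, true) : ℝ) : ℂ) * Complex.I) a.1)).prod).trace.re) (coords y) :=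
    ((contDiff_word (L := L) l (m := 1)).continuous.comp (continuous_coords (L := L))).measurable
  have e1 : ∫ y, (fun y : (Edge 3 L × Fin 2 × Fin 2 × Bool → ℝ) => ((l.map (fun a : Edge 3 L × Bool => if a.2 then ((fun (ee : Edge 3 L) => Matrix.of fun (i j : Fin 2) => ((y (ee, i, j, false) : ℝ) : ℂ) + ((y (ee, i, j, true) : ℝ) : ℂ) * Complex.I) a.1)ᴴ else (fun (ee : Edge 3 L) => Matrix.of fun (i j : Fin 2) => ((y (ee, i, j, false) : ℝ) : ℂ) + ((y (ee, i, j, true) : ℝ) : ℂ) * Complex.I) a.1)).prod).trace.re) (coords y) ∂(κ t x₀) = ∫ ω, (fun y : (Edge 3 L × Fin 2 × Fin 2 × Bool → ℝ) => ((l.map (fun a : Edge 3 L × Bool => if a.2 then ((fun (ee : Edge 3 L) => Matrix.of fun (i j : Fin 2) => ((y (ee, i, j, false) : ℝ) : ℂ) + ((y (ee, i, j, true) : ℝ) : ℂ) * Complex.I) a.1)ᴴ else (fun (ee : Edge 3 L) => Matrix.of fun (i j : Fin 2) => ((y (ee, i, j, false) : ℝ) : ℂ) + ((y (ee, i, j,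 true) : ℝ) : ℂ) * Complex.I) a.1)).prod).trace.re) (coords (U t ω)) ∂P := by
    rw [hlaw, integral_map hmU.aemeasurable hFm.aestronglyMeasurable]
  rw [← e1]
  exact h

/-! ## §4. Random starts: the bounds from an arbitrary initial law -/

/-- ★★ **Every-start ⇒ every initial LAW.**  At `|β'| < 1/12`, for every probability measure `ν` on configurations (the initial law), every
realising kernel family, every `C⁵` `f` with a link-Lipschitz profile `ℓ ≥ 0` supported in `Λ` and every `t`:
`|∫ κ_t(f∘coords) dν − μ_(β')(f∘coords)| ≤ 12π·#Λ·√(Σℓ²)·((3(λ+ρ)t+1)³ + 2)·e^(−ρt)`, volume-free. [folklore] -/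
theorem wilson_local_mixing_initialLaw_of_linkLipschitz (L : ℕ) [NeZero L] (β' : ℝ) (hβ : |β'| < 1 / 12)
    (κ : ℝ≥0 → Kernel (GaugeConfig 3 L (Matrix.specialUnitaryGroup (Fin 2) ℂ))
      (GaugeConfig 3 L (Matrix.specialUnitaryGroup (Fin 2) ℂ))) [∀ t, IsMarkovKernel (κ t)]
    (hreal : ∀ (t : ℝ≥0) (x : GaugeConfig 3 L (Matrix.specialUnitaryGroup (Fin 2) ℂ))
        (Ω : Type) [MeasurableSpace Ω] (P : Measure Ω) [IsProbabilityMeasure P]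
        (W : ℝ≥0 → Ω → (Edge 3 L × NoiseIdx 2 → ℝ)) (hW : IsFlatBrownian W P)
        (U : ℝ≥0 → Ω → GaugeConfig 3 L (Matrix.specialUnitaryGroup (Fin 2) ℂ)),
        (∀ ω, U 0 ω = x) →
        (latticeLangevinDynamics (fundamentalLatticeRep 2) β').IsSolution (fundamentalRep (Fin 2))
          hW.natFiltration P W U →
        κ t x = P.map (U t))
    {f : (Edge 3 L × Fin 2 × Fin 2 × Bool → ℝ) → ℝ} (hf : ContDiff ℝ 5 f) (Λ : Finset (Edge 3 L)) {ℓ : Edge 3 L → ℝ} (hℓ : ∀ e, 0 ≤ ℓ e)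
    (hℓΛ : ∀ e, e ∉ Λ → ℓ e = 0) (t : ℝ≥0)
    (ν : Measure (GaugeConfig 3 L (Matrix.specialUnitaryGroup (Fin 2) ℂ))) [IsProbabilityMeasure ν] :
    let coords : GaugeConfig 3 L (Matrix.specialUnitaryGroup (Fin 2) ℂ) → (Edge 3 L × Fin 2 × Fin 2 × Bool → ℝ) :=
      fun V q => (fun z : ℂ => if q.2.2.2 then z.im else z.re)
        ((fundamentalRep (Fin 2) (V q.1) : Matrix (Fin 2) (Fin 2) ℂ) q.2.1 q.2.2.1)
    (∀ (e : Edge 3 L) (y y' : (GaugeConfig 3 L (Matrix.specialUnitaryGroup (Fin 2) ℂ))), (∀ g, g ≠ e → y g = y' g) →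
      |f (coords y) - f (coords y')| ≤ ℓ e * frobNorm ((y e : Matrix (Fin 2) (Fin 2) ℂ) - (y' e : Matrix (Fin 2) (Fin 2) ℂ))) →
    |∫ x, (∫ y, f (coords y) ∂(κ t x)) ∂ν - ∫ y, f (coords y) ∂(wilsonMeasure (d := 3) (L := L) (fundamentalRep (Fin 2)) β')| ≤
      12 * Real.pi * Λ.card * Real.sqrt (∑ e : Edge 3 L, ℓ e ^ 2) * ((3 * (((1300 + 4 * Real.sqrt 2) * |β'| + (1 - 12 * |β'|)) * (t : ℝ)) + 1) ^ 3 + 2) * Real.exp (-((1 - 12 * |β'|) * (t : ℝ))) := by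
  intro coords hLip
  classical
  haveI := secondCountableTopology_su2
  haveI := borelSpace_config L
  have h := wilson_local_pointwise_mixing_of_linkLipschitz L β' hβ κ hreal hf Λ hℓ hℓΛ t hLip
  have hFm : StronglyMeasurable fun y : (GaugeConfig 3 L (Matrix.specialUnitaryGroup (Fin 2) ℂ)) => f (coords y) :=
    (hf.continuous.comp (continuous_coords (L := L))).measurable.stronglyMeasurable
  have hgm : StronglyMeasurable fun x : (GaugeConfig 3 L (Matrix.specialUnitaryGroup (Fin 2) ℂ)) => ∫ y, f (coords y) ∂(κ t x) := hFm.integral_kernel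
  exact abs_integral_sub_le_of_forall ν hgm h

/-- ★★ **Mixing time from an arbitrary initial law**: for every probability measure `ν` on configurations, every `δ > 0` and every
`t ≥ (2/ρ)·log(C_f/δ)`: `|∫ κ_t(f∘coords) dν − μ_(β')(f∘coords)| ≤ δ`, every volume. [folklore] -/
theorem wilson_local_mixingTime_initialLaw_of_linkLipschitz (L : ℕ) [NeZero L] (β' : ℝ) (hβ : |β'| < 1 / 12)
    (κ : ℝ≥0 → Kernel (GaugeConfig 3 L (Matrix.specialUnitaryGroup (Fin 2) ℂ))
      (GaugeConfig 3 L (Matrix.specialUnitaryGroup (Fin 2) ℂ))) [∀ t, IsMarkovKernel (κ t)]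
    (hreal : ∀ (t : ℝ≥0) (x : GaugeConfig 3 L (Matrix.specialUnitaryGroup (Fin 2) ℂ))
        (Ω : Type) [MeasurableSpace Ω] (P : Measure Ω) [IsProbabilityMeasure P]
        (W : ℝ≥0 → Ω → (Edge 3 L × NoiseIdx 2 → ℝ)) (hW : IsFlatBrownian W P)
        (U : ℝ≥0 → Ω → GaugeConfig 3 L (Matrix.specialUnitaryGroup (Fin 2) ℂ)),
        (∀ ω, U 0 ω = x) →
        (latticeLangevinDynamics (fundamentalLatticeRep 2) β').IsSolution (fundamentalRep (Fin 2))
          hW.natFiltration P W U →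
        κ t x = P.map (U t))
    {f : (Edge 3 L × Fin 2 × Fin 2 × Bool → ℝ) → ℝ} (hf : ContDiff ℝ 5 f) (Λ : Finset (Edge 3 L)) {ℓ : Edge 3 L → ℝ} (hℓ : ∀ e, 0 ≤ ℓ e)
    (hℓΛ : ∀ e, e ∉ Λ → ℓ e = 0) {δ : ℝ} (hδ : 0 < δ) (t : ℝ≥0)
    (ht : 2 / (1 - 12 * |β'|) * Real.log (12 * Real.pi * Λ.card * Real.sqrt (∑ e : Edge 3 L, ℓ e ^ 2) * (6 * (7 + 6 * ((1300 + 4 * Real.sqrt 2) * |β'|) / (1 - 12 * |β'|)) ^ 3 + 2) / δ) ≤ (t : ℝ))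
    (ν : Measure (GaugeConfig 3 L (Matrix.specialUnitaryGroup (Fin 2) ℂ))) [IsProbabilityMeasure ν] :
    let coords : GaugeConfig 3 L (Matrix.specialUnitaryGroup (Fin 2) ℂ) → (Edge 3 L × Fin 2 × Fin 2 × Bool → ℝ) :=
      fun V q => (fun z : ℂ => if q.2.2.2 then z.im else z.re)
        ((fundamentalRep (Fin 2) (V q.1) : Matrix (Fin 2) (Fin 2) ℂ) q.2.1 q.2.2.1)
    (∀ (e : Edge 3 L) (y y' : (GaugeConfig 3 L (Matrix.specialUnitaryGroup (Fin 2) ℂ))), (∀ g, g ≠ e → y g = y' g) →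
      |f (coords y) - f (coords y')| ≤ ℓ e * frobNorm ((y e : Matrix (Fin 2) (Fin 2) ℂ) - (y' e : Matrix (Fin 2) (Fin 2) ℂ))) →
    |∫ x, (∫ y, f (coords y) ∂(κ t x)) ∂ν - ∫ y, f (coords y) ∂(wilsonMeasure (d := 3) (L := L) (fundamentalRep (Fin 2)) β')| ≤ δ := by
  intro coords hLip
  classical
  haveI := secondCountableTopology_su2
  haveI := borelSpace_config L
  have h := wilson_local_mixingTime_of_linkLipschitz L β' hβ κ hreal hf Λ hℓ hℓΛ hδ t ht hLip
  have hFm : StronglyMeasurable fun y : (GaugeConfig 3 L (Matrix.specialUnitaryGroup (Fin 2) ℂ)) => f (coords y) :=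
    (hf.continuous.comp (continuous_coords (L := L))).measurable.stronglyMeasurable
  have hgm : StronglyMeasurable fun x : (GaugeConfig 3 L (Matrix.specialUnitaryGroup (Fin 2) ℂ)) => ∫ y, f (coords y) ∂(κ t x) := hFm.integral_kernel
  exact abs_integral_sub_le_of_forall ν hgm h

end Summit.QuantumFields.YangMills.Theorems.ColdStartUniversality.LiebRobinson
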